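import Literature.AlgebraicGeometry.AbelianSchemes.AbelianSchemeDualTransportLambda
import Literature.AlgebraicGeometry.AbelianSchemes.AbelianSchemeDualTransportOfBaseChangeAnyBase
import Literature.AlgebraicGeometry.AbelianSchemes.MumfordBundleClassifierBaseChange
import Literature.AlgebraicGeometry.AbelianSchemes.NormalisedBundleBaseChange
import Literature.AlgebraicGeometry.AbelianSchemes.LDeltaCubeLocus
import Literature.AlgebraicGeometry.Modules.PushforwardBaseChangeHomComp
import Literature.AlgebraicGeometry.Modules.PushforwardBaseChangeOpenImmersion
import HarnessLib

/-!
# Transport of the clauses of [MumfordFogartyKirwan1994] Prop. 7.3 along an isomorphism of abelian schemes: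
# the frame clause (VI), polarisations along `(e, Ĥ_e)`, the normalised sheaf `L′`, the letter of `Λ(L′)` under base change

Topic `AlgebraicGeometry/AbelianSchemes`; namespace `Literature.AlgebraicGeometry.AbelianSchemes.AbelianSchemeOver`; universe `0`.
Cell hodgecm-mathlib (D-0151), F-DAG leaf F-6, capstone (H-int): the plumbing of the (H-int) part 2 `MFKSubfunctorOfHilbIntrinsicIff`
that is NOT in ★ `MumfordBundleIsoTransport` (B-p17 (g14): (T1) `Λ` under homomorphisms, (T2) the classification letter along
`(e, Ĥ_e)`); B-p02 (g14).  THEOREMS ONLY; books 0.  HC_CM is proved only modulo the 7 printed citations until rung 0 closes; this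
file discharges none of them.

* `isIso_pullback_map_comp_pushforwardBaseChangeHom_of_isPullback_of_isPullback` — the frame clause (VI) «`b^*u ≫ β` is an
  isomorphism» does not depend on the cartesian square chosen over `(p, b)` (★ `…_iff_of_paste`, ★
  `isIso_pushforwardBaseChangeHom_of_isOpenImmersion` along `𝟙 T`);
* `Polarization.exists_lam_eq_lamTransport` — a polarisation of `(A, D)` moves along an isomorphism `e : A' ≅ A` of abelian
  schemes and the dual transport to a polarisation of `(A', D')` with `λ' = e ≫ λ ≫ Ĥ_{e⁻¹}` (★ `lamTransport`, ★
  `isLambdaOfAt_lamTransport'`, ★ `isMonHom_hatTransportOver_of_isLocallyNoetherian_base`);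
* (T3) `nonempty_pullback_normalised_iso_of_comp_eq` — the normalised sheaf `M ⊗ π^*(ε^*M)^∨` moves along any `G : A' → A`
  with `G ≫ π = π'`, `ε' ≫ G = ε` (rank-one class road of ★ `nonempty_pullback_normalised_iso_normalised_pullback`);
* `nonempty_normalised_iso_of_iso` — congruence of the normalised sheaf; `forall_nonempty_classify_pullback_map` — the
  classification letter of `Λ(L′)` base-changes to the normalised sheaf of `M|_{A ×_S S'}` (★
  `nonempty_pullbackP_baseChange_iso_pullback_mumfordBundle`, ★ `nonempty_pullback_normalised_iso_normalised_pullback`).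

## References
* [MumfordFogartyKirwan1994] D. Mumford, J. Fogarty, F. Kirwan, *Geometric Invariant Theory*, 3rd ed. (1994), Ch. 6 §2
  Definition 6.2 (p. 120), Prop. 6.10 (p. 121), Prop. 6.11 (p. 122), Ch. 7 §2 Definition 7.2 and Definition 7.3 (p. 129),
  Proposition 7.3 and its proof (pp. 132–134).
* [MilneAV2008] J. S. Milne, *Abelian Varieties* (v2.00, 2008), I §8 pp. 36–37.
* [Hartshorne1977] R. Hartshorne, *Algebraic Geometry* (1977), III Ex. 4.5.
* [StacksProject] The Stacks Project, Tag 02N6.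
-/

set_option backward.isDefEq.respectTransparency false

noncomputable section

open CategoryTheory CategoryTheory.Limits AlgebraicGeometry MonoidalCategory MonObj

namespace Literature.AlgebraicGeometry.AbelianSchemes

namespace AbelianSchemeOver

open Literature.AlgebraicGeometry.Motives Literature.AlgebraicGeometry.Modules Literature.AlgebraicGeometry.AbelianVarieties
open scoped MonObj

section Plumbing

/-- Congruence of the (VI)-clause in the top and bottom arrows of the square. [folklore] -/
private theorem isIso_pullback_map_comp_pushforwardBaseChangeHom_congr {X S T XT : Scheme.{0}} {p : X ⟶ S}
    {b b' : T ⟶ S} {pr pr' : XT ⟶ X} {pT : XT ⟶ T} (hb : b = b') (hpr : pr = pr')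
    {w : pr ≫ p = pT ≫ b} {w' : pr' ≫ p = pT ≫ b'} (G : X.Modules) {E : S.Modules}
    (u : E ⟶ (Scheme.Modules.pushforward p).obj G) :
    IsIso ((Scheme.Modules.pullback b).map u ≫ pushforwardBaseChangeHom w G) ↔
      IsIso ((Scheme.Modules.pullback b').map u ≫ pushforwardBaseChangeHom w' G) := by
  subst hb; subst hpr; exact Iff.rfl

/-- **The frame clause (VI) does not depend on the cartesian square chosen over `(p, b)`**: two pullback squares differ
by the comparison isomorphism `XT ≅ XT'`, a cartesian square over `𝟙 T`, along which the base-change morphism is an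
isomorphism (★ `isIso_pushforwardBaseChangeHom_of_isOpenImmersion`); paste (★ `…_iff_of_paste`).
[cite: MumfordFogartyKirwan1994, Ch. 7 §2 Prop. 7.3, step (VI) of the proof (p. 134)] [cite: StacksProject, Tag 02N6] -/
theorem isIso_pullback_map_comp_pushforwardBaseChangeHom_of_isPullback_of_isPullback {X S T XT XT' : Scheme.{0}}
    {p : X ⟶ S} {b : T ⟶ S} {pr : XT ⟶ X} {pT : XT ⟶ T} {pr' : XT' ⟶ X} {pT' : XT' ⟶ T}
    (H : IsPullback pr pT p b) (H' : IsPullback pr' pT' p b) (G : X.Modules) {E : S.Modules}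
    (u : E ⟶ (Scheme.Modules.pushforward p).obj G)
    (hVI : IsIso ((Scheme.Modules.pullback b).map u ≫ pushforwardBaseChangeHom H.w G)) :
    IsIso ((Scheme.Modules.pullback b).map u ≫ pushforwardBaseChangeHom H'.w G) := by
  -- the comparison square over `𝟙 T`
  have hfst : (H.isoIsPullback _ _ H').inv ≫ pr = pr' := H.isoIsPullback_inv_fst _ _ H'
  have hsnd : (H.isoIsPullback _ _ H').inv ≫ pT = pT' := H.isoIsPullback_inv_snd _ _ H'
  have HE : IsPullback (H.isoIsPullback _ _ H').inv pT' pT (𝟙 T) :=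
    IsPullback.of_horiz_isIso ⟨by rw [hsnd, Category.comp_id]⟩
  have w' : ((H.isoIsPullback _ _ H').inv ≫ pr) ≫ p = pT' ≫ 𝟙 T ≫ b := by
    rw [hfst, Category.id_comp]; exact H'.w
  haveI := isIso_pushforwardBaseChangeHom_of_isOpenImmersion HE ((Scheme.Modules.pullback pr).obj G)
  have h1 : IsIso ((Scheme.Modules.pullback (𝟙 T)).map
      ((Scheme.Modules.pullback b).map u ≫ pushforwardBaseChangeHom H.w G) ≫
        pushforwardBaseChangeHom HE.w ((Scheme.Modules.pullback pr).obj G)) := by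
    haveI := hVI; infer_instance
  rw [isIso_pullback_map_comp_pushforwardBaseChangeHom_iff_of_paste H.w HE.w w' G u] at h1
  exact (isIso_pullback_map_comp_pushforwardBaseChangeHom_congr (Category.id_comp b) hfst G u).1 h1

variable {S : Scheme.{0}} [IsLocallyNoetherian S] {A A' : AbelianSchemeOver S}

/-- **A polarisation moves along an isomorphism of abelian schemes**: for `e : A' ≅ A` (a homomorphism), dual pairs
`D`, `D'` with the unit hypotheses, and a polarisation `λ` of `(A, D)`, the transported `λ' = e ≫ λ ≫ Ĥ_{e⁻¹} : A' → Â'`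
(★ `lamTransport`) is a polarisation of `(A', D')`: a homomorphism (★ `isMonHom_hatTransportOver_of_isLocallyNoetherian_base`)
with `λ̄' = Λ(𝒪(e_s^*Θ))` at every geometric point (★ `isLambdaOfAt_lamTransport'`; `e_s^*Θ` ample).
[cite: MumfordFogartyKirwan1994, Ch. 6 §2 Definition 6.2 (p. 120)] [cite: MumfordFogartyKirwan1994, Ch. 7 §2 Definition 7.2 (p. 129)] -/
theorem Polarization.exists_lam_eq_lamTransport (D : A.DualPair) (D' : A'.DualPair) (e : A'.X ≅ A.X) [IsMonHom e.hom]
    (e' : A.X ≅ A'.X) [IsMonHom e'.hom] (he' : e'.hom = e.inv)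
    (hD : Nonempty ((Scheme.Modules.pullback (DualPair.unitHatSlice D)).obj D.P ≅ SheafOfModules.unit _))
    (hD' : Nonempty ((Scheme.Modules.pullback (DualPair.unitHatSlice D')).obj D'.P ≅ SheafOfModules.unit _))
    (pol : A.Polarization D) :
    ∃ pol' : A'.Polarization D', pol'.lam = DualPair.lamTransport D D' e e' pol.lam := by
  haveI := pol.isMonHom
  haveI := DualPair.isMonHom_hatTransportOver_of_isLocallyNoetherian_base D' D e' hD' hD
  refine ⟨{ lam := DualPair.lamTransport D D' e e' pol.lam
            isMonHom := by unfold DualPair.lamTransport; infer_instance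
            exists_ample := fun Ω _ _ s => ?_ }, rfl⟩
  obtain ⟨Θ, hΘ, hl⟩ := pol.exists_ample Ω s
  haveI := isIso_toSchemeHom_of_iso (fibreIsoOfIso e s)
  haveI := isDominant_toSchemeHom_fibreIsoOfIso e s
  exact ⟨Θ.pullback _, hΘ.pullback _, DualPair.isLambdaOfAt_lamTransport' e s D D' e' pol.lam he' hl⟩

/-- **The normalised sheaf moves along any morphism of abelian schemes over `S` compatible with the structure maps and
the units** — `G^*(M ⊗ π^*(ε^*M)^∨) ≅ G^*M ⊗ π'^*(ε'^*(G^*M))^∨` for `G : A' → A` with `G ≫ π = π'`, `ε' ≫ G = ε` (e.g. an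
isomorphism of group schemes, or the projection of a base change: ★ `nonempty_pullback_normalised_iso_normalised_pullback`,
whose rank-one class road this copies: both classes are `G^*[M] · (π'^*ε'^*G^*[M])⁻¹`).
[cite: MumfordFogartyKirwan1994, Ch. 7 §2 Proposition 7.3 (pp. 132–134)] [cite: Hartshorne1977, III Ex. 4.5] -/
theorem nonempty_pullback_normalised_iso_of_comp_eq {S : Scheme.{0}} {A A' : AbelianSchemeOver S}
    (G : A'.X.left ⟶ A.X.left) (hG : G ≫ A.X.hom = A'.X.hom) (hε : A'.unitSection ≫ G = A.unitSection)
    {M : A.left.Modules} (hM : HasRank M 1) :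
    Nonempty ((Scheme.Modules.pullback G).obj
        (tensorObj M ((Scheme.Modules.pullback A.X.hom).obj
          (Modules.dual ((Scheme.Modules.pullback A.unitSection).obj M)))) ≅
      tensorObj ((Scheme.Modules.pullback G).obj M)
        ((Scheme.Modules.pullback A'.X.hom).obj
          (Modules.dual ((Scheme.Modules.pullback A'.unitSection).obj
            ((Scheme.Modules.pullback G).obj M))))) := by
  -- ranks
  have hεM : HasRank ((Scheme.Modules.pullback A.unitSection).obj M) 1 := hasRank_pullback _ hM
  have hQd : HasRank (Modules.dual ((Scheme.Modules.pullback A.unitSection).obj M)) 1 := hasRank_dual hεM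
  have hQ : HasRank ((Scheme.Modules.pullback A.X.hom).obj
      (Modules.dual ((Scheme.Modules.pullback A.unitSection).obj M))) 1 := hasRank_pullback _ hQd
  have hL : HasRank (tensorObj M ((Scheme.Modules.pullback A.X.hom).obj
      (Modules.dual ((Scheme.Modules.pullback A.unitSection).obj M)))) 1 := hasRank_tensorObj_one hM hQ
  have hLg : HasRank ((Scheme.Modules.pullback G).obj
      (tensorObj M ((Scheme.Modules.pullback A.X.hom).obj
        (Modules.dual ((Scheme.Modules.pullback A.unitSection).obj M))))) 1 := hasRank_pullback _ hL
  have hMg : HasRank ((Scheme.Modules.pullback G).obj M) 1 :=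
    hasRank_pullback _ hM
  have hεMg : HasRank ((Scheme.Modules.pullback A'.unitSection).obj
      ((Scheme.Modules.pullback G).obj M)) 1 :=
    hasRank_pullback _ hMg
  have hQgd : HasRank (Modules.dual ((Scheme.Modules.pullback A'.unitSection).obj
      ((Scheme.Modules.pullback G).obj M))) 1 := hasRank_dual hεMg
  have hQg : HasRank ((Scheme.Modules.pullback A'.X.hom).obj
      (Modules.dual ((Scheme.Modules.pullback A'.unitSection).obj
        ((Scheme.Modules.pullback G).obj M)))) 1 :=
    hasRank_pullback _ hQgd
  have hR : HasRank (tensorObj ((Scheme.Modules.pullback G).obj M)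
      ((Scheme.Modules.pullback A'.X.hom).obj
        (Modules.dual ((Scheme.Modules.pullback A'.unitSection).obj
          ((Scheme.Modules.pullback G).obj M))))) 1 :=
    hasRank_tensorObj_one hMg hQg
  let fM := HasRank.isFiniteLocallyFree' hM
  let fεM := HasRank.isFiniteLocallyFree' hεM
  let fQd := HasRank.isFiniteLocallyFree' hQd
  let fQ := HasRank.isFiniteLocallyFree' hQ
  let fL := HasRank.isFiniteLocallyFree' hL
  let fLg := HasRank.isFiniteLocallyFree' hLg
  let fMg := HasRank.isFiniteLocallyFree' hMg
  let fεMg := HasRank.isFiniteLocallyFree' hεMg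
  let fQgd := HasRank.isFiniteLocallyFree' hQgd
  let fQg := HasRank.isFiniteLocallyFree' hQg
  let fR := HasRank.isFiniteLocallyFree' hR
  -- the class of `pr^*M`
  have hMgc : detClass fMg = CechPic.pullback G (detClass fM) :=
    (detClass_eq_of_iso (Iso.refl _) fMg (fM.pullback _)).trans (detClass_pullback _ fM)
  -- the class of the left side
  have h1 : detClass fLg = CechPic.pullback G (detClass fM) *
      (CechPic.pullback G
        (CechPic.pullback A.X.hom (CechPic.pullback A.unitSection (detClass fM))))⁻¹ := by
    rw [(detClass_eq_of_iso (Iso.refl _) fLg (fL.pullback _)).trans (detClass_pullback _ fL),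
      detClass_tensorObj_of_hasRank_one hM hQ fM fQ fL,
      (detClass_eq_of_iso (Iso.refl _) fQ (fQd.pullback A.X.hom)).trans (detClass_pullback A.X.hom fQd),
      detClass_dual' fεM fQd, (detClass_eq_of_iso (Iso.refl _) fεM (fM.pullback A.unitSection)).trans
        (detClass_pullback A.unitSection fM), map_mul, map_inv, map_inv]
  -- the class of the right side
  have h2 : detClass fR = CechPic.pullback G (detClass fM) *
      (CechPic.pullback A'.X.hom (CechPic.pullback A'.unitSection
        (CechPic.pullback G (detClass fM))))⁻¹ := by
    rw [detClass_tensorObj_of_hasRank_one hMg hQg fMg fQg fR,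
      (detClass_eq_of_iso (Iso.refl _) fQg (fQgd.pullback A'.X.hom)).trans
        (detClass_pullback A'.X.hom fQgd),
      detClass_dual' fεMg fQgd, (detClass_eq_of_iso (Iso.refl _) fεMg (fMg.pullback A'.unitSection)).trans
        (detClass_pullback A'.unitSection fMg), hMgc, map_inv]
  -- the two composite morphisms `A' → A` along which `[M]` is pulled back agree
  have hmor : (G ≫ A.X.hom) ≫ A.unitSection = (A'.X.hom ≫ A'.unitSection) ≫ G := by
    rw [hG, Category.assoc, hε]
  have key : CechPic.pullback G
        (CechPic.pullback A.X.hom (CechPic.pullback A.unitSection (detClass fM))) =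
      CechPic.pullback A'.X.hom (CechPic.pullback A'.unitSection
        (CechPic.pullback G (detClass fM))) :=
    calc CechPic.pullback G (CechPic.pullback A.X.hom (CechPic.pullback A.unitSection (detClass fM)))
        = CechPic.pullback ((G ≫ A.X.hom) ≫ A.unitSection) (detClass fM) :=
          ((CechPic.pullback_comp (G ≫ A.X.hom) A.unitSection _).trans
            (CechPic.pullback_comp G A.X.hom _)).symm
      _ = CechPic.pullback ((A'.X.hom ≫ A'.unitSection) ≫
            G) (detClass fM) :=
          congrArg (CechPic.pullback · (detClass fM)) hmor
      _ = CechPic.pullback A'.X.hom (CechPic.pullback A'.unitSection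
            (CechPic.pullback G (detClass fM))) :=
          (CechPic.pullback_comp (A'.X.hom ≫ A'.unitSection) G _).trans
            (CechPic.pullback_comp A'.X.hom A'.unitSection _)
  refine (nonempty_iso_iff_detClass_eq hLg hR fLg fR).2 ?_
  rw [h1, h2, key]


omit [IsLocallyNoetherian S] in
/-- The normalised sheaves `M ⊗ π^*(ε^*M)^∨` of isomorphic rank-one modules are isomorphic (functoriality of `⊗`, `π^*`,
`ε^*` and ★ `nonempty_dual_congr`). [cite: MumfordFogartyKirwan1994, Ch. 7 §2 Proposition 7.3 (pp. 132–134)] -/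
theorem nonempty_normalised_iso_of_iso (A : AbelianSchemeOver S) {M M' : A.left.Modules} (i : M ≅ M')
    (hM : HasRank M 1) :
    Nonempty (tensorObj M ((Scheme.Modules.pullback A.X.hom).obj
        (Modules.dual ((Scheme.Modules.pullback A.unitSection).obj M))) ≅
      tensorObj M' ((Scheme.Modules.pullback A.X.hom).obj
        (Modules.dual ((Scheme.Modules.pullback A.unitSection).obj M')))) := by
  obtain ⟨d⟩ := nonempty_dual_congr ((Scheme.Modules.pullback A.unitSection).mapIso i) (hasRank_pullback _ hM)
  exact ⟨tensorMapIso i ((Scheme.Modules.pullback A.X.hom).mapIso d)⟩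

end Plumbing

/-! ### The classification letter of `Λ(L′)` base-changes to the normalised sheaf of `M|_{A ×_S S'}` -/

section ClassifyPullbackMap

variable {S S' : Scheme.{0}} (A : AbelianSchemeOver S) (g : S' ⟶ S) (D : A.DualPair) {M : A.left.Modules}

/-- **`(Over.pullback g).map Λ(L′)` classifies the Mumford family of the NORMALISED sheaf of `M|_{A ×_S S'}`** for the
base-changed dual pair: ★ `nonempty_pullbackP_baseChange_iso_pullback_mumfordBundle` gives it for `(L′)|_{A ×_S S'}`, and ★
`nonempty_pullback_normalised_iso_normalised_pullback` + ★ `forall_nonempty_classify_iff_of_nonempty_iso` re-normalise.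
[cite: MumfordFogartyKirwan1994, Ch. 6 §2 Prop. 6.10 (p. 121) and Prop. 6.11 (p. 122; proof pp. 122–123)]
[cite: MumfordFogartyKirwan1994, Ch. 7 §2 Proposition 7.3 (pp. 132–134)] -/
theorem forall_nonempty_classify_pullback_map (hM : HasRank M 1) (lam : A.X ⟶ D.hat.X)
    (hlam : ∀ ⦃U : Over S⦄ (a : U ⟶ A.X),
      Nonempty ((Scheme.Modules.pullback (A.X ◁ (a ≫ lam)).left).obj D.P ≅
        (Scheme.Modules.pullback (A.X ◁ a).left).obj (A.mumfordBundle
          (tensorObj M ((Scheme.Modules.pullback A.X.hom).obj (Modules.dual ((Scheme.Modules.pullback A.unitSection).obj M)))))))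
    ⦃U : Over S'⦄ (a : U ⟶ (A.baseChange g).X) :
    Nonempty ((Scheme.Modules.pullback ((A.baseChange g).X ◁ (a ≫ (Over.pullback g).map lam)).left).obj (D.baseChange g).P ≅
      (Scheme.Modules.pullback ((A.baseChange g).X ◁ a).left).obj ((A.baseChange g).mumfordBundle
        (tensorObj ((Scheme.Modules.pullback (pullback.fst A.X.hom g)).obj M)
          ((Scheme.Modules.pullback (A.baseChange g).X.hom).obj (Modules.dual
            ((Scheme.Modules.pullback (A.baseChange g).unitSection).obj
              ((Scheme.Modules.pullback (pullback.fst A.X.hom g)).obj M))))))) := by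
  have hM' : HasRank ((Scheme.Modules.pullback (X := (A.baseChange g).left) (pullback.fst A.X.hom g)).obj M) 1 :=
    hasRank_pullback _ hM
  obtain ⟨en⟩ := A.nonempty_pullback_normalised_iso_normalised_pullback g hM
  refine ((A.baseChange g).forall_nonempty_classify_iff_of_nonempty_iso (hasRank_pullback _ (A.hasRank_normalised _ hM))
    ((A.baseChange g).hasRank_normalised _ hM') (D.baseChange g) ((Over.pullback g).map lam) ⟨en⟩).1 (fun U' a' => ?_) a
  have h2 := A.nonempty_pullbackP_baseChange_iso_pullback_mumfordBundle g D (A.hasRank_normalised _ hM) lam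
    (fun U'' a'' => by rw [DualPair.pullbackP_eq_pullback_whiskerLeft]; exact hlam a'') a'
  rwa [DualPair.pullbackP_eq_pullback_whiskerLeft] at h2

end ClassifyPullbackMap

end AbelianSchemeOver

end Literature.AlgebraicGeometry.AbelianSchemes
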